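import Summits.BirchSwinnertonDyer.BirchSwinnertonDyer.Theorems.GenusKolyvaginAtTwoPowDvdShaCardAtTwoRTRestrictionKernelIndexTwo
import Literature.NumberTheory.EllipticCurves.LocalPointsIntegersSubgroup
import Mathlib.Data.Nat.Factorization.Basic
import HarnessLib

/-!
# Route `GenusKolyvaginAtTwo`, LINE 18 / LINE 19 (L_T `PowDvdShaCardAtTwoRT` stmt-BirchSwinnertonDyer-23242, L⁺_T
# stmt-23379), critic idea-crit-5 VERDICT #179 price (1), quantitative half — THE ONE-BIT BOUND, ABSTRACT LAYER:
# `#H¹(C₂, S) ≤ #S^{C₂}[2]` for a `C₂`-module `S` with a finite-index uniquely `2`-divisible stable subgroup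

Seat `bsd-line-gk2-p3` g17 (cell `bsd-f1-sign2`), `--supports stmt-BirchSwinnertonDyer-23242` (helper; closes nothing).
THEOREMS ONLY (no definition, no named fact, no `sorry`); BSD is not proved by any of this.

WHY.  In the (+)-descent of LINE 18 v3/v4 (`stub_twinLadderDefect`: `2M₀ ≤ ord₂ g + ord₂ g' + Σ_{v ∣ d_K∞} i_v − 1`) a class
descended from the Heegner field `K` to `ℚ` is only NORM-locally trivial at a ramified prime `p ∣ d_K`; the cost of passing
from the `d_K`-relaxed to the strict Selmer condition at `p` is the order of Matsuno's
`W_{p,K} = ker(H¹(ℚ_p, E) → H¹(K_𝔭, E)) = H¹(Gal(K_𝔭/ℚ_p), E(K_𝔭))`, which Kramer 1981 Prop. 3 computes as `2^{i_p}`,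
`i_p = dim Ẽ(𝔽_p)[2] = dim E(ℚ_p)[2]`.  The predecessor file `…RestrictionKernelIndexTwo` bounds the classes inflated at an
index-two step by `#(S/2S)` when `S = M^N` has no `2`-torsion — useless locally, where `E(K_𝔭)[2]` may be all of `E[2]`.
This file removes that hypothesis by passing to the ANTI-invariants:

* §1 `natCard_range_inflClass_le_of_index_two_of_divisible` — for `N ⊴ G` open of index two with coset generator `σ`,
  `S = M^N`, and a `σ`-stable subgroup `T ≤ S` of finite index in `S` which is uniquely `2`-divisible (`T[2] = 0`,
  `T = 2T`): the inflated classes form a FINITE group of order `≤ #{s ∈ S : σ s = s, 2 s = 0} = #(M^G)[2]`.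
  Proof (Serre I.§2.4 for the cyclic group `G/N`): `f ↦ f(σ)` identifies the cocycles vanishing on `N` with
  `S⁻ = {s ∈ S : σ s = −s}` (`smul_apply_eq_neg_apply`); `f` is principal iff `f(σ) ∈ (σ−1)S`, in particular if
  `f(σ) ∈ 2S⁻` (`inflClass_eq_zero_of_apply_eq_two_smul_of_smul_eq_neg`); so `#range(infl) ≤ #(S⁻/2S⁻)`, and
  `#(S⁻/2S⁻) = #S⁻[2]` because `T⁻ = T ∩ S⁻` is again uniquely `2`-divisible of finite index in `S⁻` (the tree's
  Herbrand identity `LocalPoints.index_range_nsmul_eq`); finally `S⁻[2] = S^σ[2]` (`−s = s` on `2`-torsion).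
* §2 `exists_pow_nsmul_uniquely_two_divisible` — the supply of `T` for a local points group: an abelian group `A` with
  a finite-index subgroup `U` without `2`-torsion and `2`-divisible (`U ≤ 2U`; for `A = E(K_w)`, `w ∤ 2`, this is
  Silverman *AEC* VII.6.3 / Milne *ADT* I.3.3, tree `exists_finiteIndex_torsionFree_adicCompletion` with
  `[U : 2U] = #(𝒪_w/2) = 1`) admits `k` with `2^k A` without `2`-torsion, `2^k A ⊆ 2^{k+1} A` and `A/2^k A` finite
  (`k = ord₂ [A : U]`, Bézout with the odd part of the index).

The field-level and `ℚ_v`-level statements (`#W_{v,K} ≤ #E(ℚ_v)[2]`) are in the sibling file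
`…RTLocalKernelOneBitLocal`.

References: [SerreGaloisCohomology1997] I.§2.4 (cohomology of a cyclic group of order 2), I.§5.8; [Kramer1981] §2
Prop. 3 and §3 (proof of Thm. 2: `ker res = infl H¹(G, E(L))`); [Matsuno2009] §3, Lemma 4.2; [MilneADT2006] I Lemma 3.3;
[SilvermanAEC2009] Prop. VII.6.3.
-/

set_option autoImplicit false
-- the Theorems namespace of this sub repeats the summit name by design (D-0017 nested layout)
set_option linter.dupNamespace false

noncomputable section

open scoped Classical

namespace Summit.BirchSwinnertonDyer.BirchSwinnertonDyer.Theorems.GenusExact.PlusDescent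

open Literature.NumberTheory.EllipticCurves Literature.NumberTheory.GaloisRepresentations

universe u

/-! ## §1 Index two: the bound through the anti-invariants -/

section IndexTwoAnti

variable {G : Type u} [Group G] [TopologicalSpace G] [IsTopologicalGroup G]
variable {M : Type u} [AddCommGroup M] [DistribMulAction G M] [TopologicalSpace M]
  [DiscreteTopology M]
variable {N : Subgroup G} {σ : G} {S : AddSubgroup M}

omit [TopologicalSpace G] [IsTopologicalGroup G] [TopologicalSpace M] [DiscreteTopology M] in
/-- The value at a coset generator `σ` of a crossed homomorphism vanishing on the index-two subgroup `N` is
ANTI-invariant under `σ`: `σ • f σ = - f σ` (from `f σ + σ f σ = f (σσ) = 0`).  So `f ↦ f σ` maps the cocycles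
vanishing on `N` to `S⁻ = {s ∈ M^N : σ s = -s}`. Serre, *Galois Cohomology*, I.§2.4. [folklore] -/
theorem smul_apply_eq_neg_apply (hσ : ∀ b : G, Xor (b * σ ∈ N) (b ∈ N)) (f : cocyclesVanishingOn M N) :
    σ • f.1 σ = -f.1 σ :=
  eq_neg_of_add_eq_zero_right (apply_add_smul_apply_eq_zero hσ f)

/-- **A cocycle whose value at `σ` is `σ b - b` with `b` invariant under `N` is principal** (index two, `N` open
normal, `S = M^N`): `f g = g • b - b` for all `g` (both sides vanish on `N` and agree on `N σ`).  I.e. the class of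
`f` in `H¹(G/N, S) = S⁻/(σ-1)S` is read off `f(σ) mod (σ-1)S`. Serre, *Galois Cohomology*, I.§2.4 and I.§5.8. [folklore] -/
theorem inflClass_eq_zero_of_apply_eq_smul_sub [N.Normal] (hN : IsOpen (N : Set G))
    (hσ : ∀ b : G, Xor (b * σ ∈ N) (b ∈ N)) (hS : ∀ m : M, m ∈ S ↔ ∀ n ∈ N, n • m = m)
    (f : cocyclesVanishingOn M N) {b : M} (hb : b ∈ S) (hfb : f.1 σ = σ • b - b) :
    inflClass M N hN f = 0 := by
  rw [inflClass_apply, oneCocycleClass_eq_zero_iff]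
  refine ⟨b, fun g ↦ ?_⟩
  rw [discreteTopRep_ρ_apply, toContOneCocycle_apply]
  by_cases hg : g ∈ N
  · rw [cocyclesVanishingOn.apply_of_mem f hg, (hS b).mp hb g hg, sub_self]
  · obtain ⟨n, hn, rfl⟩ := exists_eq_mul_of_not_mem hσ hg
    rw [cocyclesVanishingOn.apply_of_mem_mul f σ hn, cocyclesVanishingOn.smul_apply f σ hn, hfb,
      mul_smul, (hS _).mp (smul_mem_of_invariants hS hb σ) n hn]

/-- **Index-two inflation: a cocycle whose value at `σ` is twice an ANTI-invariant is principal** — the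
`2`-torsion-free hypothesis of `inflClass_eq_zero_of_apply_eq_two_smul` replaced by `σ t = -t`: then
`2t = σ(-t) - (-t)`, so `inflClass_eq_zero_of_apply_eq_smul_sub` applies with `b = -t`.
Serre, *Galois Cohomology*, I.§2.4. [folklore] -/
theorem inflClass_eq_zero_of_apply_eq_two_smul_of_smul_eq_neg [N.Normal] (hN : IsOpen (N : Set G))
    (hσ : ∀ b : G, Xor (b * σ ∈ N) (b ∈ N)) (hS : ∀ m : M, m ∈ S ↔ ∀ n ∈ N, n • m = m)
    (f : cocyclesVanishingOn M N) {t : M} (ht : t ∈ S) (hσt : σ • t = -t) (hft : f.1 σ = 2 • t) :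
    inflClass M N hN f = 0 :=
  inflClass_eq_zero_of_apply_eq_smul_sub hN hσ hS f (S.neg_mem ht)
    (by rw [hft, smul_neg, hσt, neg_neg, sub_neg_eq_add, two_nsmul])

/-- **THE INDEX-TWO INFLATION BOUND THROUGH THE ANTI-INVARIANTS (`#H¹(C₂, S) ≤ #S^{C₂}[2]`).**  Let `N ≤ G` be
an open normal subgroup with a coset generator `σ` (index two), `S = M^N`, and `T ≤ S` a `σ`-stable subgroup of
finite index in `S` which is uniquely `2`-divisible (`T[2] = 0` and every `t ∈ T` is `2u` with `u ∈ T`).  Then the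
subgroup of `H¹_cont(G, M)` of classes inflated from crossed homomorphisms vanishing on `N` is FINITE, of order at
most `#{s ∈ S : σ s = s, 2 s = 0}` (the `2`-torsion of the `G`-invariants).  Proof: evaluation at `σ` maps the
cocycles into `S⁻ = {s ∈ S : σ s = -s}` (`smul_apply_eq_neg_apply`) and a cocycle with `f(σ) ∈ 2 S⁻` is principal
(`inflClass_eq_zero_of_apply_eq_two_smul_of_smul_eq_neg`), so `range(infl)` is a quotient of a subgroup of
`S⁻/2S⁻`; `T⁻ = T ∩ S⁻` is uniquely `2`-divisible (`2(σu + u) = σ t + t = 0` in `T` forces `σ u = -u`) of finite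
index in `S⁻`, so `#(S⁻/2S⁻) = [T⁻ : 2T⁻] · #S⁻[2] = #S⁻[2]` (`LocalPoints.index_range_nsmul_eq`), and
`S⁻[2] = {s ∈ S : σ s = s, 2s = 0}`.  (For `G = Γ_F ⊇ N = Γ_L`, `[L:F] = 2`, `M = E(F̄)`:
`#H¹(Gal(L/F), E(L)) ≤ #E(F)[2]` as soon as `E(L)` has a finite-index uniquely `2`-divisible subgroup — every
non-archimedean local field of residue characteristic `≠ 2`.) Serre, *Galois Cohomology*, I.§2.4; Kramer 1981 §2
Prop. 3 (upper bound `#H¹(G, E(L)) = 2^{i(L/F)} ≤ #Ẽ(k)[2]`).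
[cite: SerreGaloisCohomology1997, I.§2.4 and I.§5.8] [cite: Kramer1981, §2 Prop. 3] -/
theorem natCard_range_inflClass_le_of_index_two_of_divisible [N.Normal] (hN : IsOpen (N : Set G))
    (hσ : ∀ b : G, Xor (b * σ ∈ N) (b ∈ N)) (S : AddSubgroup M)
    (hS : ∀ m : M, m ∈ S ↔ ∀ n ∈ N, n • m = m)
    (T : AddSubgroup M) (hTS : T ≤ S) (hσT : ∀ t ∈ T, σ • t ∈ T)
    (hT2 : ∀ t ∈ T, 2 • t = 0 → t = 0) (hTdiv : ∀ t ∈ T, ∃ u ∈ T, t = 2 • u)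
    (hfin : (T.addSubgroupOf S).FiniteIndex) :
    Finite (inflClass M N hN).range ∧
      Nat.card (inflClass M N hN).range ≤ Nat.card {m : M // m ∈ S ∧ σ • m = m ∧ 2 • m = 0} := by
  -- the anti-invariants `S⁻ = {s ∈ S | σ s = -s}`
  let Sm : AddSubgroup M :=
    { carrier := {m | m ∈ S ∧ σ • m = -m}
      zero_mem' := ⟨S.zero_mem, by rw [smul_zero, neg_zero]⟩
      add_mem' := fun {a b} ha hb ↦ ⟨S.add_mem ha.1 hb.1, by rw [smul_add, ha.2, hb.2, neg_add]⟩
      neg_mem' := fun {a} ha ↦ ⟨S.neg_mem ha.1, by rw [smul_neg, ha.2]⟩ }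
  have hSmS : Sm ≤ S := fun m hm ↦ hm.1
  -- `T⁻ = T ∩ S⁻` inside `S⁻`: finite index, no `2`-torsion, `2`-divisible
  let A : AddSubgroup Sm := T.addSubgroupOf Sm
  haveI hAidx : A.FiniteIndex := by
    refine ⟨fun h0 ↦ hfin.index_ne_zero ?_⟩
    exact AddSubgroup.relIndex_eq_zero_of_le_right hSmS h0
  have hA2 : ∀ a ∈ A, (2 : ℕ) • a = 0 → a = 0 := by
    intro a ha h0
    have h0' : 2 • (a : M) = 0 := by
      have := congrArg (fun x : Sm ↦ (x : M)) h0
      simpa only [AddSubgroupClass.coe_nsmul, ZeroMemClass.coe_zero] using this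
    exact Subtype.ext (hT2 _ (AddSubgroup.mem_addSubgroupOf.mp ha) h0')
  have hAdiv : A.map (nsmulAddMonoidHom 2 : Sm →+ Sm) = A := by
    apply le_antisymm
    · rintro _ ⟨a, ha, rfl⟩
      exact A.nsmul_mem ha 2
    · intro a ha
      have haT : (a : M) ∈ T := AddSubgroup.mem_addSubgroupOf.mp ha
      obtain ⟨u, hu, hau⟩ := hTdiv _ haT
      -- `u ∈ S⁻`: `2 (σ u + u) = σ a + a = 0` in `T`
      have h2 : 2 • (σ • u + u) = 0 := by
        rw [nsmul_add, ← smul_comm σ (2 : ℕ) u, ← hau, a.2.2, neg_add_cancel]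
      have hσu : σ • u = -u :=
        eq_neg_of_add_eq_zero_left (hT2 _ (T.add_mem (hσT u hu) hu) h2)
      refine ⟨⟨u, hTS hu, hσu⟩, AddSubgroup.mem_addSubgroupOf.mpr hu, Subtype.ext ?_⟩
      rw [nsmulAddMonoidHom_apply, AddSubgroupClass.coe_nsmul, ← hau]
  -- `[S⁻ : 2 S⁻] = #S⁻[2]`, both finite
  have hidx := Literature.NumberTheory.EllipticCurves.LocalPoints.index_range_nsmul_eq A 2 hA2
  rw [hAdiv, AddSubgroup.relIndex_self, one_mul, AddSubgroup.index] at hidx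
  haveI hkerfin : Finite (nsmulAddMonoidHom 2 : Sm →+ Sm).ker :=
    Literature.NumberTheory.EllipticCurves.LocalPoints.finite_ker_nsmul A 2 hA2
  set R : AddSubgroup Sm := (nsmulAddMonoidHom 2 : Sm →+ Sm).range with hRdef
  haveI hQfin : Finite (Sm ⧸ R) := Nat.finite_of_card_ne_zero (by rw [hidx]; exact Nat.card_pos.ne')
  -- evaluation at `σ`, with values in `S⁻`, then in `S⁻ / 2 S⁻`; its kernel consists of principal cocycles
  let Φ : cocyclesVanishingOn M N →+ Sm :=
    { toFun := fun f ↦ ⟨f.1 σ, apply_mem_of_invariants hS f σ, smul_apply_eq_neg_apply hσ f⟩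
      map_zero' := rfl
      map_add' := fun _ _ ↦ rfl }
  let Ψ : cocyclesVanishingOn M N →+ Sm ⧸ R := (QuotientAddGroup.mk' R).comp Φ
  have hker : Ψ.ker ≤ (inflClass M N hN).ker := by
    intro f hf
    rw [AddMonoidHom.mem_ker] at hf ⊢
    have hf' : (Φ f : Sm) ∈ R := (QuotientAddGroup.eq_zero_iff _).mp hf
    obtain ⟨t, ht⟩ := hf'
    refine inflClass_eq_zero_of_apply_eq_two_smul_of_smul_eq_neg hN hσ hS f (t := (t : M)) t.2.1 t.2.2 ?_
    have h := congrArg (fun x : Sm ↦ (x : M)) ht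
    simp only [nsmulAddMonoidHom_apply, AddSubgroupClass.coe_nsmul] at h
    exact h.symm
  -- the induced map on the quotient and the count
  let ι : cocyclesVanishingOn M N ⧸ Ψ.ker →+ discreteH1 G M :=
    QuotientAddGroup.lift Ψ.ker (inflClass M N hN) hker
  haveI : Finite Ψ.range := inferInstance
  haveI : Finite (cocyclesVanishingOn M N ⧸ Ψ.ker) :=
    Finite.of_equiv _ (QuotientAddGroup.quotientKerEquivRange Ψ).symm.toEquiv
  have hsurj : Function.Surjective
      (fun q : cocyclesVanishingOn M N ⧸ Ψ.ker ↦ (⟨ι q, by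
        induction q using QuotientAddGroup.induction_on with
        | H f => exact ⟨f, (QuotientAddGroup.lift_mk' Ψ.ker hker f).symm⟩⟩ : (inflClass M N hN).range)) := by
    rintro ⟨c, f, rfl⟩
    exact ⟨QuotientAddGroup.mk f, Subtype.ext (QuotientAddGroup.lift_mk' Ψ.ker hker f)⟩
  refine ⟨Finite.of_surjective _ hsurj, ?_⟩
  -- `S⁻[2] = {s ∈ S : σ s = s, 2 s = 0}`
  have e2 : (nsmulAddMonoidHom 2 : Sm →+ Sm).ker ≃ {m : M // m ∈ S ∧ σ • m = m ∧ 2 • m = 0} :=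
    { toFun := fun x ↦ ⟨(x.1 : M), x.1.2.1, by
          have h2 : 2 • (x.1 : M) = 0 := by
            have := congrArg (fun y : Sm ↦ (y : M)) ((AddMonoidHom.mem_ker).mp x.2)
            simpa only [nsmulAddMonoidHom_apply, AddSubgroupClass.coe_nsmul, ZeroMemClass.coe_zero] using this
          refine ⟨x.1.2.2.trans (neg_eq_of_add_eq_zero_right (by rwa [two_nsmul] at h2)), h2⟩⟩
      invFun := fun m ↦ ⟨⟨m.1, m.2.1, m.2.2.1.trans
          (neg_eq_of_add_eq_zero_right (by have h := m.2.2.2; rwa [two_nsmul] at h)).symm⟩,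
          (AddMonoidHom.mem_ker).mpr (Subtype.ext (by
            rw [nsmulAddMonoidHom_apply, AddSubgroupClass.coe_nsmul, ZeroMemClass.coe_zero]; exact m.2.2.2))⟩
      left_inv := fun x ↦ rfl
      right_inv := fun m ↦ rfl }
  calc Nat.card (inflClass M N hN).range
      ≤ Nat.card (cocyclesVanishingOn M N ⧸ Ψ.ker) := Nat.card_le_card_of_surjective _ hsurj
    _ = Nat.card Ψ.range := Nat.card_congr (QuotientAddGroup.quotientKerEquivRange Ψ).toEquiv
    _ ≤ Nat.card (Sm ⧸ R) := AddSubgroup.card_le_card_addGroup _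
    _ = Nat.card (nsmulAddMonoidHom 2 : Sm →+ Sm).ker := hidx
    _ = Nat.card {m : M // m ∈ S ∧ σ • m = m ∧ 2 • m = 0} := Nat.card_congr e2

end IndexTwoAnti

/-! ## §2 A finite-index `2`-divisible subgroup without `2`-torsion gives a uniquely `2`-divisible `2^k A` -/

section Divisible

variable {A : Type u} [AddCommGroup A]

/-- **`2^k A` is uniquely `2`-divisible of finite index for `k = ord₂ [A : U]`**, when `U ≤ A` has finite index,
no `2`-torsion and `U ⊆ 2U`.  With `[A : U] = 2^k m'`, `m'` odd: `[A:U]·A ⊆ U`; if `t = 2^k y` and `2t = 0` then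
`[A:U] y ∈ U` is killed by `2`, so `m' t = [A:U] y = 0` and `t = m' t − (m'−1) t = 0` (`m' − 1` even); and
`m' · 2^k y ∈ U = 2^{k+1} U`, so by Bézout (`gcd(m', 2^{k+1}) = 1`) `2^k y ∈ 2^{k+1} A`; finally `U ⊆ 2^k U ⊆ 2^k A`
has finite index.  (For `A = E(K_w)`, `w ∤ 2`: Silverman *AEC* VII.6.3 / Milne *ADT* I.3.3 supply `U`.)
[cite: SilvermanAEC2009, Prop. VII.6.3] [cite: MilneADT2006, I Lemma 3.3] -/
theorem exists_pow_nsmul_uniquely_two_divisible (U : AddSubgroup A) [U.FiniteIndex]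
    (hU2 : ∀ u ∈ U, 2 • u = 0 → u = 0) (hUdiv : ∀ u ∈ U, ∃ u' ∈ U, u = 2 • u') :
    ∃ k : ℕ, (∀ a : A, 2 • (2 ^ k • a) = 0 → 2 ^ k • a = 0) ∧
      (∀ a : A, ∃ b : A, 2 ^ k • a = 2 • (2 ^ k • b)) ∧
      Finite (A ⧸ (nsmulAddMonoidHom (2 ^ k) : A →+ A).range) := by
  -- `[A : U] = 2^k m'`, `m'` odd; `[A:U] • a ∈ U`
  obtain ⟨k, m', hm', hidx⟩ := Nat.exists_eq_two_pow_mul_odd (AddSubgroup.FiniteIndex.index_ne_zero (H := U))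
  have hmem : ∀ a : A, m' • (2 ^ k • a) ∈ U := by
    intro a
    rw [← mul_nsmul', mul_comm, ← hidx]
    exact AddSubgroup.nsmul_index_mem U a
  -- `U ⊆ 2^j U` for every `j`
  have hUdivPow : ∀ (j : ℕ) (u : A), u ∈ U → ∃ u' ∈ U, u = 2 ^ j • u' := by
    intro j
    induction j with
    | zero => exact fun u hu ↦ ⟨u, hu, by rw [pow_zero, one_nsmul]⟩
    | succ j ih =>
      intro u hu
      obtain ⟨u₁, hu₁, rfl⟩ := ih u hu
      obtain ⟨u₂, hu₂, rfl⟩ := hUdiv u₁ hu₁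
      exact ⟨u₂, hu₂, by rw [pow_succ, mul_nsmul']⟩
  refine ⟨k, fun a h2 ↦ ?_, fun a ↦ ?_, ?_⟩
  · -- no `2`-torsion in `2^k A`: `m' (2^k a) = [A:U]-multiple ∈ U` is killed by `2`, and `m'` is odd
    have hm0 : m' • (2 ^ k • a) = 0 := by
      refine hU2 _ (hmem a) ?_
      rw [← mul_nsmul', mul_comm, mul_nsmul', h2, nsmul_zero]
    obtain ⟨r, hr⟩ := hm'
    rw [hr, add_nsmul, one_nsmul, mul_nsmul, h2, nsmul_zero, zero_add] at hm0
    exact hm0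
  · -- `2^k a ∈ 2^{k+1} A`: Bézout with `m' (2^k a) ∈ U = 2^{k+1} U`
    obtain ⟨u', -, hu⟩ := hUdivPow (k + 1) _ (hmem a)
    have hcop : IsCoprime (m' : ℤ) ((2 ^ (k + 1) : ℕ) : ℤ) :=
      Nat.isCoprime_iff_coprime.mpr (Nat.Coprime.pow_right _ (Nat.coprime_two_right.mpr hm'))
    obtain ⟨x, y, hxy⟩ := hcop
    refine ⟨x • u' + y • (2 ^ k • a), ?_⟩
    set c : A := 2 ^ k • a with hc
    calc c = (1 : ℤ) • c := (one_zsmul c).symm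
      _ = (x * (m' : ℤ) + y * ((2 ^ (k + 1) : ℕ) : ℤ)) • c := by rw [hxy]
      _ = x • ((m' : ℤ) • c) + y • (((2 ^ (k + 1) : ℕ) : ℤ) • c) := by rw [add_smul, mul_smul, mul_smul]
      _ = x • ((2 ^ (k + 1) : ℕ) • u') + y • ((2 ^ (k + 1) : ℕ) • c) := by
          rw [natCast_zsmul, natCast_zsmul, hu]
      _ = (2 ^ (k + 1) : ℕ) • (x • u' + y • c) := by rw [smul_comm x, smul_comm y, ← smul_add]
      _ = 2 • (2 ^ k • (x • u' + y • c)) := by rw [pow_succ', mul_nsmul']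
  · -- `A / 2^k A` is finite: `U ⊆ 2^k U ⊆ 2^k A`
    have hle : U ≤ (nsmulAddMonoidHom (2 ^ k) : A →+ A).range := by
      intro u hu
      obtain ⟨u', -, rfl⟩ := hUdivPow k u hu
      exact ⟨u', rfl⟩
    haveI := AddSubgroup.finiteIndex_of_le hle
    infer_instance

end Divisible

end Summit.BirchSwinnertonDyer.BirchSwinnertonDyer.Theorems.GenusExact.PlusDescent

end
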